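import Literature.Probability.LatticeModels.TorusFourier
import Mathlib.NumberTheory.LegendreSymbol.AddCharacter
import Mathlib.Analysis.Normed.Ring.Finite
import HarnessLib

/-!
# Discrete Fourier analysis on `(ℤ/Lℤ)^d`: proofs of the `TorusFourier` facts

Trunk G02 (T-STATMECH), topic `Probability/LatticeModels`, namespace `Literature.StatMech`.

`TorusFourier.lean` records the discrete Fourier transform on the torus `(ℤ/Lℤ)^d`
(`torusFourier`, `torusFourierInv`), lattice momenta, the free dispersion relation and the
Fourier transform of torus two-point functions, together with seven elementary statements left
there as named facts (`def … : Prop`). This file **proves all seven**: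

* `torusFourier_inversion_holds`, `torusFourier_torusFourierInv_holds` (Fourier inversion),
* `torusFourier_plancherel_holds` (Parseval),
* `torusFourier_one_eq_dft_holds` (agreement with Mathlib's `ZMod.dft` for `d = 1`),
* `dispersion_eq_zero_iff_holds`, `dispersion_latticeMomentum_eq_zero_iff_holds`,
* `twoPointFourierTorus_im_eq_zero_holds` (evenness ⇒ reality of `Ĝ_L`),

from the orthogonality of the characters `χ_k(x) = ∏ᵢ e^{2πi kᵢxᵢ/L}` of `(ℤ/Lℤ)^d`
(`torusChar`, `sum_torusChar_left/right`; Mathlib: `ZMod.stdAddChar`, `AddChar.sum_mulShift`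
with `ZMod.isPrimitive_stdAddChar`). It also provides the two identities used for Gaussian
domination in `x`-space (Aizenman–Duminil-Copin–Sidoravicius 2015, (3.13); Fröhlich–Simon–Spencer
1976, §3): the real part of a character is the cosine of the lattice-momentum phase
(`torusChar_re`), and the **quadratic form of a convolution kernel in Fourier variables**
(`sum_sum_mul_torusFourierInv_re`):
`∑_{x,y} r_x r_y Re (𝓕⁻¹g)(x - y) = L^{-d} ∑_k Re g(k) ‖𝓕r(k)‖²` for real `r`.

References: Friedli–Velenik 2017, §10.4 (Fourier analysis on the torus for the infrared
bound); Stein–Shakarchi, *Fourier Analysis*, Ch. 7 (finite Fourier analysis).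

## Mathlib status

Mathlib has the `d = 1` transform `ZMod.dft` with inversion (`ZMod.dft_dft`) but no
multi-dimensional version and no Parseval for it; the proofs here are self-contained via
character sums.
-/

noncomputable section

open Finset ZMod Complex
open scoped ComplexConjugate Real

namespace Literature.Probability.LatticeModels

variable {d L : ℕ}

/-! ### Characters of `(ℤ/Lℤ)^d` -/

/-- The character `χ_k(x) = ∏ᵢ e^{2πi kᵢ xᵢ / L}` of the finite abelian group `(ℤ/Lℤ)^d`
attached to `k ∈ (ℤ/Lℤ)^d` (Friedli–Velenik 2017, §10.4; Mathlib `ZMod.stdAddChar` in each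
coordinate). [cite: FriedliVelenik2017, §10.4] -/
def torusChar [NeZero L] (k x : TorusSite d L) : ℂ :=
  ∏ i, stdAddChar (k i * x i)

section Char

variable [NeZero L]

/-- `χ_k(x) = χ_x(k)`. [folklore] -/
theorem torusChar_comm (k x : TorusSite d L) : torusChar k x = torusChar x k := by
  simp [torusChar, mul_comm]

/-- `χ_k(0) = 1`. [folklore] -/
@[simp] theorem torusChar_zero_right (k : TorusSite d L) : torusChar k 0 = 1 := by
  simp [torusChar]

/-- `χ_0(x) = 1`. [folklore] -/
@[simp] theorem torusChar_zero_left (x : TorusSite d L) : torusChar 0 x = 1 := by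
  simp [torusChar]

/-- `χ_k(x + y) = χ_k(x) χ_k(y)`. [folklore] -/
theorem torusChar_add_right (k x y : TorusSite d L) :
    torusChar k (x + y) = torusChar k x * torusChar k y := by
  simp [torusChar, mul_add, AddChar.map_add_eq_mul, prod_mul_distrib]

/-- `χ_k(-x) = conj χ_k(x)`. [folklore] -/
theorem torusChar_neg_right (k x : TorusSite d L) :
    torusChar k (-x) = conj (torusChar k x) := by
  simp [torusChar, AddChar.map_neg_eq_conj, map_prod]

/-- `χ_k(x - y) = χ_k(x) conj χ_k(y)`. [folklore] -/
theorem torusChar_sub_right (k x y : TorusSite d L) :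
    torusChar k (x - y) = torusChar k x * conj (torusChar k y) := by
  rw [sub_eq_add_neg, torusChar_add_right, torusChar_neg_right]

/-- `χ_{k - k'}(x) = χ_k(x) conj χ_{k'}(x)`. [folklore] -/
theorem torusChar_sub_left (k k' x : TorusSite d L) :
    torusChar (k - k') x = torusChar k x * conj (torusChar k' x) := by
  rw [torusChar_comm, torusChar_sub_right, torusChar_comm x k, torusChar_comm x k']

/-- `‖χ_k(x)‖ = 1`. [folklore] -/
@[simp] theorem norm_torusChar (k x : TorusSite d L) : ‖torusChar k x‖ = 1 := by
  simp [torusChar, norm_prod]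

/-- `χ_k(x) conj χ_k(x) = 1`. [folklore] -/
theorem torusChar_mul_conj (k x : TorusSite d L) : torusChar k x * conj (torusChar k x) = 1 := by
  rw [mul_conj, Complex.normSq_eq_norm_sq, norm_torusChar]
  simp

/-- The kernel of `torusFourier` is the conjugate character:
`∏ᵢ e^{-2πi kᵢxᵢ/L} = conj χ_k(x)`. [folklore] -/
theorem prod_stdAddChar_neg (k x : TorusSite d L) :
    ∏ i, (stdAddChar (-(k i * x i)) : ℂ) = conj (torusChar k x) := by
  simp [torusChar, AddChar.map_neg_eq_conj, map_prod]

/-- `torusFourier f k = ∑_x f(x) conj χ_k(x)`. [folklore] -/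
theorem torusFourier_eq_sum_torusChar (f : TorusSite d L → ℂ) (k : TorusSite d L) :
    torusFourier f k = ∑ x, f x * conj (torusChar k x) := by
  simp [torusFourier, prod_stdAddChar_neg]

/-- `torusFourierInv g x = L^{-d} ∑_k g(k) χ_k(x)`. [folklore] -/
theorem torusFourierInv_eq_sum_torusChar (g : TorusSite d L → ℂ) (x : TorusSite d L) :
    torusFourierInv g x = ((L : ℂ) ^ d)⁻¹ * ∑ k, g k * torusChar k x := by
  simp [torusFourierInv, torusChar]

/-- **Orthogonality of characters** (sum over the character index):
`∑_k χ_k(x) = L^d` if `x = 0` and `0` otherwise (the `d`-fold product of the one-dimensional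
orthogonality relation on `ℤ/Lℤ`, Mathlib `AddChar.sum_mulShift` with `ZMod.isPrimitive_stdAddChar`). [folklore] -/
theorem sum_torusChar_left (x : TorusSite d L) :
    ∑ k, torusChar k x = if x = 0 then (L : ℂ) ^ d else 0 := by
  classical
  have h1 : ∀ i, ∑ a : ZMod L, (stdAddChar (a * x i) : ℂ) =
      if x i = 0 then (L : ℂ) else 0 := fun i => by
    rw [AddChar.sum_mulShift (x i) (isPrimitive_stdAddChar L), ZMod.card, Nat.cast_ite, Nat.cast_zero]
  have : ∑ k : TorusSite d L, torusChar k x = ∏ i, ∑ a : ZMod L, (stdAddChar (a * x i) : ℂ) := by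
    rw [Finset.prod_univ_sum]
    simp [torusChar, Fintype.piFinset_univ]
  rw [this]
  simp_rw [h1]
  split_ifs with hx
  · simp [hx]
  · obtain ⟨i, hi⟩ : ∃ i, x i ≠ 0 := by
      by_contra h
      push Not at h
      exact hx (funext h)
    exact Finset.prod_eq_zero (Finset.mem_univ i) (if_neg hi)

/-- **Orthogonality of characters** (sum over the group): `∑_x χ_k(x) = L^d` if `k = 0` and `0`
otherwise. [folklore] -/
theorem sum_torusChar_right (k : TorusSite d L) :
    ∑ x, torusChar k x = if k = 0 then (L : ℂ) ^ d else 0 := by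
  simp_rw [torusChar_comm k]
  exact sum_torusChar_left k

/-- `(L : ℂ)^d ≠ 0` for `L ≠ 0`. [folklore] -/
theorem natCast_pow_ne_zero : ((L : ℂ) ^ d) ≠ 0 :=
  pow_ne_zero _ (Nat.cast_ne_zero.2 (NeZero.ne L))

/-- Convolution with the character sum is evaluation: `∑_x F(x) ∑_k χ_k(z - x) = L^d F(z)`. [folklore] -/
theorem sum_mul_sum_torusChar_sub (F : TorusSite d L → ℂ) (z : TorusSite d L) :
    ∑ x, F x * ∑ k, torusChar k (z - x) = (L : ℂ) ^ d * F z := by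
  simp_rw [sum_torusChar_left, sub_eq_zero, mul_ite, mul_zero]
  rw [Finset.sum_ite_eq]
  simp [mul_comm]

/-- Dual form: `∑_{k'} F(k') ∑_x χ_{k' - k}(x) = L^d F(k)`. [folklore] -/
theorem sum_mul_sum_torusChar_sub_left (F : TorusSite d L → ℂ) (k : TorusSite d L) :
    ∑ k', F k' * ∑ x, torusChar (k' - k) x = (L : ℂ) ^ d * F k := by
  simp_rw [sum_torusChar_right, sub_eq_zero, mul_ite, mul_zero]
  rw [Finset.sum_ite_eq']
  simp [mul_comm]

/-! ### Inversion, Parseval, and the `d = 1` comparison -/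

omit [NeZero L] in
/-- **Fourier inversion on `(ℤ/Lℤ)^d`** (`TorusFourier.torusFourier_inversion`):
`torusFourierInv (torusFourier f) = f` (Friedli–Velenik 2017, §10.4; Stein–Shakarchi Ch. 7,
Thm. 1.2 for `d = 1`). [cite: FriedliVelenik2017, §10.4] -/
theorem torusFourier_inversion_holds : torusFourier_inversion (d := d) (L := L) := by
  intro _ f
  funext z
  rw [torusFourierInv_eq_sum_torusChar]
  have : ∑ k, torusFourier f k * torusChar k z = ∑ x, f x * ∑ k, torusChar k (z - x) := by
    simp_rw [torusFourier_eq_sum_torusChar, Finset.sum_mul, Finset.mul_sum]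
    rw [Finset.sum_comm]
    refine Finset.sum_congr rfl fun x _ => Finset.sum_congr rfl fun k _ => ?_
    rw [torusChar_sub_right]
    ring
  rw [this, sum_mul_sum_torusChar_sub, ← mul_assoc, inv_mul_cancel₀ natCast_pow_ne_zero, one_mul]

omit [NeZero L] in
/-- **Fourier inversion, second form** (`TorusFourier.torusFourier_torusFourierInv`):
`torusFourier (torusFourierInv g) = g`. [folklore] -/
theorem torusFourier_torusFourierInv_holds : torusFourier_torusFourierInv (d := d) (L := L) := by
  intro _ g
  funext k
  rw [torusFourier_eq_sum_torusChar]
  have h1 : ∀ x, torusFourierInv g x * conj (torusChar k x) =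
      ((L : ℂ) ^ d)⁻¹ * ∑ k', g k' * torusChar (k' - k) x := fun x => by
    rw [torusFourierInv_eq_sum_torusChar, mul_assoc, Finset.sum_mul]
    congr 1
    refine Finset.sum_congr rfl fun k' _ => ?_
    rw [torusChar_sub_left]
    ring
  simp_rw [h1]
  rw [← Finset.mul_sum, Finset.sum_comm]
  simp_rw [← Finset.mul_sum]
  rw [sum_mul_sum_torusChar_sub_left, ← mul_assoc, inv_mul_cancel₀ natCast_pow_ne_zero, one_mul]

/-- Parseval in complex form: `∑_k 𝓕f(k) conj 𝓕f(k) = L^d ∑_x f(x) conj f(x)`. [folklore] -/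
theorem sum_torusFourier_mul_conj (f : TorusSite d L → ℂ) :
    ∑ k, torusFourier f k * conj (torusFourier f k) =
      (L : ℂ) ^ d * ∑ x, f x * conj (f x) := by
  have : ∀ k, torusFourier f k * conj (torusFourier f k) =
      ∑ x, ∑ y, f x * conj (f y) * torusChar k (y - x) := fun k => by
    rw [torusFourier_eq_sum_torusChar, map_sum, Finset.sum_mul_sum]
    refine Finset.sum_congr rfl fun x _ => Finset.sum_congr rfl fun y _ => ?_
    rw [map_mul, Complex.conj_conj, torusChar_sub_right]
    ring
  simp_rw [this]
  rw [Finset.sum_comm]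
  rw [Finset.mul_sum]
  refine Finset.sum_congr rfl fun x _ => ?_
  rw [Finset.sum_comm]
  have : ∑ y, ∑ k, f x * conj (f y) * torusChar k (y - x) =
      ∑ y, (f x * conj (f y)) * ∑ k, torusChar k (y - x) := by
    simp_rw [Finset.mul_sum]
  rw [this]
  simp_rw [sum_torusChar_left, sub_eq_zero, mul_ite, mul_zero]
  rw [Finset.sum_ite_eq']
  simp [mul_comm]

omit [NeZero L] in
/-- **Parseval/Plancherel on `(ℤ/Lℤ)^d`** (`TorusFourier.torusFourier_plancherel`):
`∑_k ‖𝓕f(k)‖² = L^d ∑_x ‖f(x)‖²` for the unnormalised transform (Friedli–Velenik 2017, §10.4;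
Stein–Shakarchi Ch. 7). [cite: FriedliVelenik2017, §10.4] -/
theorem torusFourier_plancherel_holds : torusFourier_plancherel (d := d) (L := L) := by
  intro _ f
  have h := sum_torusFourier_mul_conj f
  simp_rw [mul_conj, Complex.normSq_eq_norm_sq] at h
  exact_mod_cast h

omit [NeZero L] in
/-- **`torusFourier` for `d = 1` is Mathlib's `ZMod.dft`** (`TorusFourier.torusFourier_one_eq_dft`),
transported along `Equiv.funUnique (Fin 1) (ZMod L)` (Mathlib `ZMod.dft_apply`). [folklore] -/
theorem torusFourier_one_eq_dft_holds : torusFourier_one_eq_dft (L := L) := by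
  intro _ f k
  rw [ZMod.dft_apply, torusFourier]
  rw [← Equiv.sum_comp (Equiv.funUnique (Fin 1) (ZMod L))]
  refine Finset.sum_congr rfl fun x _ => ?_
  have hx : (Equiv.funUnique (Fin 1) (ZMod L)).symm (Equiv.funUnique (Fin 1) (ZMod L) x) = x :=
    Equiv.symm_apply_apply _ _
  simp only [Function.comp_apply, hx, smul_eq_mul]
  simp [mul_comm]

/-! ### The dispersion relation -/

/-- **Zeros of the dispersion relation** (`TorusFourier.dispersion_eq_zero_iff`):
`ε(p) = ∑ᵢ (1 - cos pᵢ) = 0 ↔ p ∈ (2πℤ)^d` (Mathlib `Real.cos_eq_one_iff`). [folklore] -/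
theorem dispersion_eq_zero_iff_holds : dispersion_eq_zero_iff (d := d) := by
  intro p
  unfold dispersion
  rw [Finset.sum_eq_zero_iff_of_nonneg fun i _ => sub_nonneg.2 (Real.cos_le_one (p i))]
  simp only [Finset.mem_univ, forall_true_left, sub_eq_zero]
  refine forall_congr' fun i => ?_
  rw [eq_comm, Real.cos_eq_one_iff]

end Char

/-- **The dispersion vanishes on lattice momenta only at `k = 0`**
(`TorusFourier.dispersion_latticeMomentum_eq_zero_iff`; Friedli–Velenik 2017, §10.4). [cite: FriedliVelenik2017, §10.4] -/
theorem dispersion_latticeMomentum_eq_zero_iff_holds :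
    dispersion_latticeMomentum_eq_zero_iff (d := d) (L := L) := by
  intro _ k
  rw [dispersion_eq_zero_iff_holds]
  have hL : (0 : ℝ) < L := Nat.cast_pos.2 (Nat.pos_of_ne_zero (NeZero.ne L))
  constructor
  · intro h
    funext i
    obtain ⟨n, hn⟩ := h i
    simp only [latticeMomentum] at hn
    -- n * 2π = 2π * val / L  ⇒  n * L = val, with 0 ≤ val < L  ⇒  n = 0
    have hval : ((k i).val : ℝ) = n * L := by
      field_simp at hn
      linarith [hn, Real.pi_pos]
    have h0 : (0 : ℝ) ≤ n := by
      have : (0 : ℝ) ≤ (k i).val := Nat.cast_nonneg _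
      rw [hval] at this
      exact nonneg_of_mul_nonneg_left this hL
    have h1 : (n : ℝ) < 1 := by
      have : ((k i).val : ℝ) < L := Nat.cast_lt.2 (ZMod.val_lt (k i))
      rw [hval] at this
      by_contra hc
      push Not at hc
      have := mul_le_mul_of_nonneg_right hc hL.le
      linarith
    have hn0 : n = 0 := by
      have h0' : (0 : ℤ) ≤ n := by exact_mod_cast h0
      have h1' : n < 1 := by exact_mod_cast h1
      omega
    rw [hn0] at hval
    simp only [Int.cast_zero, zero_mul, Nat.cast_eq_zero] at hval
    rw [Pi.zero_apply, ← ZMod.val_eq_zero, hval]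
  · rintro rfl i
    exact ⟨0, by simp [latticeMomentum]⟩

section Char

variable [NeZero L]

/-! ### Real parts: cosines, and the quadratic form of a convolution kernel -/

/-- A standard character value in exponential form with the product of representatives:
`e(k x) = exp (2πi k.val x.val / L)`. [folklore] -/
theorem stdAddChar_mul_eq_exp (a b : ZMod L) :
    (stdAddChar (a * b) : ℂ) = Complex.exp (2 * π * I * ((a.val * b.val : ℕ) : ℝ) / L) := by
  have : a * b = ((a.val * b.val : ℕ) : ℤ) := by
    push_cast
    rw [ZMod.natCast_zmod_val, ZMod.natCast_zmod_val]
  rw [this, ZMod.stdAddChar_coe]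
  push_cast
  ring_nf

/-- **The real part of a character is the cosine of the lattice-momentum phase**:
`Re χ_k(x) = cos (∑ᵢ pᵢ xᵢ.val)` with `p = latticeMomentum L k = 2πk/L`
(Friedli–Velenik 2017, §10.4). [cite: FriedliVelenik2017, §10.4] -/
theorem torusChar_re (k x : TorusSite d L) :
    (torusChar k x).re = Real.cos (∑ i, latticeMomentum L k i * ((x i).val : ℝ)) := by
  have : torusChar k x = Complex.exp ((∑ i, latticeMomentum L k i * ((x i).val : ℝ) : ℝ) * I) := by
    unfold torusChar
    simp_rw [stdAddChar_mul_eq_exp, ← Complex.exp_sum]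
    congr 1
    push_cast
    rw [Finset.sum_mul]
    refine Finset.sum_congr rfl fun i _ => ?_
    simp only [latticeMomentum]
    push_cast
    ring
  rw [this, Complex.exp_ofReal_mul_I_re]

/-- The quadratic form of a convolution kernel in Fourier variables (complex form):
`∑_{x,y} v_x conj(v_y) (𝓕⁻¹g)(x - y) = L^{-d} ∑_k g(k) · w_k conj(w_k)`, `w_k = ∑_x v_x χ_k(x)`. [folklore] -/
theorem sum_sum_mul_torusFourierInv (g v : TorusSite d L → ℂ) :
    ∑ x, ∑ y, v x * conj (v y) * torusFourierInv g (x - y) =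
      ((L : ℂ) ^ d)⁻¹ * ∑ k, g k * ((∑ x, v x * torusChar k x) * conj (∑ x, v x * torusChar k x)) := by
  -- expand the right-hand side into a triple sum and compare termwise
  have hR : ∀ k, g k * ((∑ x, v x * torusChar k x) * conj (∑ x, v x * torusChar k x)) =
      ∑ x, ∑ y, g k * (v x * conj (v y) * torusChar k (x - y)) := fun k => by
    rw [map_sum, Finset.sum_mul_sum, Finset.mul_sum]
    refine Finset.sum_congr rfl fun x _ => ?_
    rw [Finset.mul_sum]
    refine Finset.sum_congr rfl fun y _ => ?_
    rw [map_mul, torusChar_sub_right]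
    ring
  have hL : ∀ x y, v x * conj (v y) * torusFourierInv g (x - y) =
      ((L : ℂ) ^ d)⁻¹ * ∑ k, g k * (v x * conj (v y) * torusChar k (x - y)) := fun x y => by
    rw [torusFourierInv_eq_sum_torusChar, Finset.mul_sum, Finset.mul_sum, Finset.mul_sum]
    refine Finset.sum_congr rfl fun k _ => ?_
    ring
  calc ∑ x, ∑ y, v x * conj (v y) * torusFourierInv g (x - y)
      = ∑ x, ∑ y, ((L : ℂ) ^ d)⁻¹ * ∑ k, g k * (v x * conj (v y) * torusChar k (x - y)) := by
        simp_rw [hL]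
    _ = ((L : ℂ) ^ d)⁻¹ * ∑ x, ∑ y, ∑ k, g k * (v x * conj (v y) * torusChar k (x - y)) := by
        simp_rw [← Finset.mul_sum]
    _ = ((L : ℂ) ^ d)⁻¹ * ∑ x, ∑ k, ∑ y, g k * (v x * conj (v y) * torusChar k (x - y)) := by
        congr 1
        exact Finset.sum_congr rfl fun x _ => Finset.sum_comm
    _ = ((L : ℂ) ^ d)⁻¹ * ∑ k, ∑ x, ∑ y, g k * (v x * conj (v y) * torusChar k (x - y)) := by
        congr 1
        exact Finset.sum_comm
    _ = ((L : ℂ) ^ d)⁻¹ * ∑ k, g k * ((∑ x, v x * torusChar k x) *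
          conj (∑ x, v x * torusChar k x)) := by
        simp_rw [hR]

/-- For a real sequence, `‖∑_x r_x χ_k(x)‖ = ‖𝓕r(k)‖` (the two sums are complex conjugate). [folklore] -/
theorem sum_mul_torusChar_eq_conj_torusFourier (r : TorusSite d L → ℝ) (k : TorusSite d L) :
    ∑ x, (r x : ℂ) * torusChar k x = conj (torusFourier (fun x => (r x : ℂ)) k) := by
  rw [torusFourier_eq_sum_torusChar, map_sum]
  refine Finset.sum_congr rfl fun x _ => ?_
  rw [map_mul, Complex.conj_conj, Complex.conj_ofReal]

/-- **Quadratic form of a convolution kernel in Fourier variables** (real form): for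
`g : (ℤ/Lℤ)^d → ℂ` and real `r`,
`∑_{x,y} r_x r_y Re (𝓕⁻¹g)(x - y) = L^{-d} ∑_k Re g(k) ‖𝓕r(k)‖²`.
This is the finite Fourier identity behind Gaussian domination in `x`-space
(Fröhlich–Simon–Spencer 1976, §3; Aizenman–Duminil-Copin–Sidoravicius 2015, (3.13)). [cite: FrohlichSimonSpencer1976, §3] -/
theorem sum_sum_mul_torusFourierInv_re (g : TorusSite d L → ℂ) (r : TorusSite d L → ℝ) :
    ∑ x, ∑ y, r x * r y * (torusFourierInv g (x - y)).re =
      (((L : ℝ) ^ d)⁻¹) * ∑ k, (g k).re * ‖torusFourier (fun x => (r x : ℂ)) k‖ ^ 2 := by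
  have hw : ∀ k, (∑ x, (r x : ℂ) * torusChar k x) * conj (∑ x, (r x : ℂ) * torusChar k x) =
      ((‖torusFourier (fun x => (r x : ℂ)) k‖ ^ 2 : ℝ) : ℂ) := fun k => by
    rw [sum_mul_torusChar_eq_conj_torusFourier, Complex.conj_conj, mul_comm, mul_conj,
      Complex.normSq_eq_norm_sq]
  have hR : ∑ k, g k * ((∑ x, (r x : ℂ) * torusChar k x) * conj (∑ x, (r x : ℂ) * torusChar k x))
      = ∑ k, g k * ((‖torusFourier (fun x => (r x : ℂ)) k‖ ^ 2 : ℝ) : ℂ) :=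
    Finset.sum_congr rfl fun k _ => by rw [hw]
  have hL : ∑ x, ∑ y, (r x : ℂ) * conj (r y : ℂ) * torusFourierInv g (x - y) =
      ∑ x, ∑ y, ((r x * r y : ℝ) : ℂ) * torusFourierInv g (x - y) :=
    Finset.sum_congr rfl fun x _ => Finset.sum_congr rfl fun y _ => by
      rw [Complex.conj_ofReal, ← Complex.ofReal_mul]
  have h := sum_sum_mul_torusFourierInv g (fun x => (r x : ℂ))
  rw [hR, hL] at h
  have h' := congrArg Complex.re h
  rw [Complex.re_sum] at h'
  simp_rw [Complex.re_sum, Complex.re_ofReal_mul] at h'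
  rw [h']
  have hc : (((L : ℂ) ^ d)⁻¹) = ((((L : ℝ) ^ d)⁻¹ : ℝ) : ℂ) := by push_cast; rfl
  rw [hc, Complex.re_ofReal_mul, Complex.re_sum]
  simp_rw [Complex.mul_re, Complex.ofReal_re, Complex.ofReal_im, mul_zero, sub_zero]

end Char

/-! ### Reality of the Fourier transform of an even two-point function -/

/-- **Evenness ⇒ reality** (`TorusFourier.twoPointFourierTorus_im_eq_zero`): if `μ` is invariant
under `x ↦ -x`, then `G_L(-x) = G_L(x)` and `Ĝ_L(k)` is real (Friedli–Velenik 2017, §10.4,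
discussion after (10.36)). [cite: FriedliVelenik2017, §10.4] -/
theorem twoPointFourierTorus_im_eq_zero_holds :
    twoPointFourierTorus_im_eq_zero (d := d) (L := L) := by
  intro _ μ hμ k
  -- evenness of the two-point function
  have heven : ∀ x : TorusSite d L, torusTwoPoint μ (-x) = torusTwoPoint μ x := fun x => by
    have hmeas : Measurable fun σ : SpinConfig (TorusSite d L) => fun y => σ (-y) :=
      measurable_pi_lambda _ fun y => measurable_pi_apply (-y)
    have hobs : spinPair (0 : TorusSite d L) (-x) =
        fun σ => spinPair 0 x (fun y => σ (-y)) := by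
      funext σ
      simp [spinPair, spinAt]
    unfold torusTwoPoint spinTwoPoint
    rw [hobs, ← MeasureTheory.integral_map hmeas.aemeasurable
      (measurable_spinPair 0 x).aestronglyMeasurable, hμ]
  -- self-conjugacy of the transform
  rw [← Complex.conj_eq_iff_im, twoPointFourierTorus, torusFourier_eq_sum_torusChar, map_sum]
  rw [← Equiv.sum_comp (Equiv.neg (TorusSite d L))]
  refine Finset.sum_congr rfl fun x _ => ?_
  rw [Equiv.neg_apply, map_mul, Complex.conj_conj, Complex.conj_ofReal, heven,
    torusChar_neg_right]

end Literature.Probability.LatticeModels
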